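import Literature.Probability.RandomPlanarGeometry.YangBaxterSAW
import HarnessLib

/-!
# Self-avoiding walk on `ℤ²` with Yang–Baxter weights: the undischarged named facts

Topic `Literature/Probability/RandomPlanarGeometry`; module split `defn-YangBaxterSAWFacts` (no new
mathematics, no statement change). A. Glazman, I. Manolescu, *Self-avoiding walk on `ℤ²` with
Yang–Baxter weights: universality of critical fugacity and 2-point function*, Ann. Inst. Henri
Poincaré Probab. Stat. 56 (2020), arXiv:1708.00395v3 (bib key `GlazmanManolescu2019`; numbering of
the arXiv version).

This file hosts, VERBATIM (same names, same namespace
`Literature.Probability.RandomPlanarGeometry.SAW.YangBaxter`, same statements; docstrings as moved, except that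
the docstring of `GlazmanManolescu2019_prop11` was updated 2026-08-22 with the published source that proves it),
the two named facts of the paper that are NOT discharged and that used to sit next to the definitions
in `YangBaxterSAW.lean`:

* `GlazmanManolescu2019_prop11` — Proposition 1.1 as it was (mis-)quoted there, WITHOUT the cube:
  `Σ_T B_{T,π/3}/T < ∞`. The printed eq. (3) is `Σ_T (B_{T,π/3})³/T < ∞`; since `B_T ≤ 1` the
  cube-free statement is strictly stronger and is NOT what Glazman–Manolescu prove (audit seats: as a
  quotation of Proposition 1.1 it is MISSTATED; the printed eq. (3) and its printed consequences are tree
  theorems — `GlazmanManolescu2019_eq3`, `HV.summable_stripBlim_cube_div`, `GlazmanManolescu2019_prop11_logBound`,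
  `HV.stripBlim_lt_log_rpow_frequently` in `HexSAWBridgeCubeSum.lean`; `YangBaxterSAWBridgeDecay.lean` records
  `GlazmanManolescu2019_prop11_cube_of_prop11`, i.e. that this statement implies (3)). The statement IS
  nevertheless a published THEOREM in substance: D. Krachun, C. Panagiotis, *Quantitative sub-ballisticity of
  self-avoiding walk on the hexagonal lattice*, Ann. Probab. (2026), arXiv:2310.17299, Theorem 2 ("Let
  `ε = 10^{-10}`. For every `T ≥ 1` we have `B_T ≤ 100 · T^{-ε}`") gives `B_T(π/3) ≤ B_T(x_c) ≤ 100 T^{-ε}`,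
  whence `Σ_T B_T(π/3)/T ≤ 100 Σ_T T^{-1-ε} < ∞`; in the tree this implication is
  `GlazmanManolescu2019_prop11_of_bridgeDecay : 0 < η → BridgeDecay C η → GlazmanManolescu2019_prop11`
  (`YangBaxterSAWProp11OfBridgeDecay.lean`), and Krachun–Panagiotis's theorem with an explicit exponent is the
  Summits-side `…HexConjecture.RootLocality.KPExplicit.stripBlim_decay_explicit` (`BridgeDecay 200 (7/10⁹)`),
  which Literature may not import — the discharge `GlazmanManolescu2019_prop11_holds` is ONE LINE once that
  chain lives under `Literature/`. The declaration is kept unchanged (named facts are never edited in place).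
* `GlazmanManolescu2019_thm3` — Theorem 3, `y_c(Θ) = 1 + √2` when `θ₁ = π/3`, with its corollary
  `GlazmanManolescu2019_thm3.criticalSurfaceFugacity_eq`.

WHY A SEPARATE FILE: `YangBaxterSAW.lean` / `YangBaxterSAWLaw.lean` define the objects (`Face`,
`MidEdge`, `YBWalk`, the weights, `halfPlane`, `bridgePartitionFunction`, `subcriticalFugacities`, …)
over which the cruxes of the routes `SAWTrackTransport` and `SAWCompassLattice` of
`CriticalPhenomena/SAWScalingLimit` are stated; with the two unproved facts in the definitions file
the import cone of those routes could never be free of unproved facts, although no item depends on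
either. The discharged facts `GlazmanManolescu2019_thm1` / `_thm2` stay in `YangBaxterSAW.lean`
(their `_holds` are in `YangBaxterSAWTheoremsHolds.lean`).
-/

noncomputable section

open Real Filter
open _root_.Topology
open scoped ENNReal

namespace Literature.Probability.RandomPlanarGeometry.SAW.YangBaxter

/-! ### Named facts (statements only) -/

/-- **Glazman–Manolescu, Proposition 1.1 — MIS-QUOTED here (the cube is missing).** This
declaration renders the proposition as "`Σ_{T ≥ 1} B_{T,π/3} / T < ∞`" (bridges of the hexagonal
lattice, all angles `π/3`). The source — arXiv v1 (2017), v3 (2019) and the journal alike — states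
and proves "We have `Σ_{T ≥ 1} (1/T) (B_T(π/3))³ < ∞` (3)", with the CUBE of `B_T` (the cube is
intrinsic to the proof, §4.1, which concatenates three walks rotated by `0, π/3, 2π/3`). Since
`B_T ≤ 1` (Corollary 2.3), the statement below is strictly STRONGER than eq. (3)
(`GlazmanManolescu2019_prop11_cube_of_prop11` in `YangBaxterSAWBridgeDecay.lean`) and is NOT proved
by Glazman–Manolescu; it must not be mistaken for their Proposition 1.1. It IS, however, true and
published in substance: Krachun–Panagiotis's Theorem 2 (Ann. Probab. 2026, arXiv:2310.17299: "Let
`ε = 10^{-10}`. For every `T ≥ 1` we have `B_T ≤ 100 · T^{-ε}`", `B_T = B_T(x_c)` Duminil-Copin–Smirnov's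
critical bridge partition function of the strip of width `T`) implies it, because
`B_T(π/3) ≤ B_T(x_c)` (`bridgePartitionFunction_pi_div_three_le_stripBlim`) and `Σ_T T^{-1-ε} < ∞` — in
the tree: `GlazmanManolescu2019_prop11_of_bridgeDecay` (`YangBaxterSAWProp11OfBridgeDecay.lean`) fed with
any `BridgeDecay C η`, `η > 0`; the explicit Krachun–Panagiotis decay is at present a Summits-side theorem
(`KPExplicit.stripBlim_decay_explicit`), so `GlazmanManolescu2019_prop11_holds` waits for that chain to
move under `Literature/`. The declaration is left unchanged (named facts are never edited in place).
The printed eq. (3), in these conventions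
`(∑' T : ℕ, bridgePartitionFunction (T + 1) (fun _ => π / 3) ^ 3 / (T + 1 : ℝ≥0∞)) < ⊤`, is the tree
theorem `GlazmanManolescu2019_eq3` (`HexSAWBridgeCubeSum.lean`), and its printed consequences
("`B_T(π/3) → 0`" = `GlazmanManolescu2019_prop11_limit` of `YangBaxterSAWTwoPoint.lean`;
"`B_T(π/3) < 1/(log T)^{1/3}` for infinitely many `T`" = `GlazmanManolescu2019_prop11_logBound`) are
proved in `YangBaxterSAWBridgeDecay.lean` / `HexSAWBridgeCubeSum.lean`.
[cite: KrachunPanagiotis2026, Theorem 2 (implies the statement: B_T ≤ 100·T^{-10^{-10}} for all T ≥ 1)]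
[cite: GlazmanManolescu2019, Proposition 1.1, eq. (3) (mis-quoted without the cube)] -/
def GlazmanManolescu2019_prop11 : Prop :=
  (∑' T : ℕ, bridgePartitionFunction (T + 1) (fun _ => π / 3) / (T + 1 : ℝ≥0∞)) < ⊤

/-- **Glazman–Manolescu, Theorem 3.** "Let `Θ = {θ_k}_{k∈ℕ}`, where `θ₁ = π/3` and
`θ_k ∈ [π/3, 2π/3]` for `k > 1`. Then `y_c(Θ) = 1 + √2`." Stated as: `1 + √2` is the least upper
bound of `{y ≥ 0 | ∀ 0 < x < 1, SAW_Θ(x, y) < ∞}` (which yields `criticalSurfaceFugacity Θ = 1 + √2`,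
see `GlazmanManolescu2019_thm3.criticalSurfaceFugacity_eq`). [cite: GlazmanManolescu2019, Theorem 3] -/
def GlazmanManolescu2019_thm3 : Prop :=
  ∀ Θ : ℤ → ℝ, Θ 0 = π / 3 → (∀ k, Θ k ∈ Set.Icc (π / 3) (2 * π / 3)) →
    IsLUB (subcriticalFugacities Θ) (1 + Real.sqrt 2)

/-- Theorem 3 in the form `y_c(Θ) = 1 + √2`. [cite: GlazmanManolescu2019, Theorem 3] -/
theorem GlazmanManolescu2019_thm3.criticalSurfaceFugacity_eq (h : GlazmanManolescu2019_thm3)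
    (Θ : ℤ → ℝ) (h0 : Θ 0 = π / 3) (hΘ : ∀ k, Θ k ∈ Set.Icc (π / 3) (2 * π / 3)) :
    criticalSurfaceFugacity Θ = 1 + Real.sqrt 2 := by
  have hl := h Θ h0 hΘ
  refine hl.csSup_eq ?_
  by_contra hne
  rw [Set.not_nonempty_iff_eq_empty] at hne
  rw [hne, isLUB_empty_iff] at hl
  exact not_isBot (1 + Real.sqrt 2) hl

end Literature.Probability.RandomPlanarGeometry.SAW.YangBaxter
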